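import Summits.QuantumFields.YangMills.Theorems.TransportPerturbationFixedCutoffOverlapLargeWindow
import Summits.QuantumFields.YangMills.Theorems.ColdStartUniversalityLatticeLangevinDoeblinHaarAllTimes
import HarnessLib

/-!
# Route `TransportPerturbation`, LINE 10 «harris_hybrid» (crux K1 `LyapunovContraction`, stmt-QuantumFields-26986): the BC5
# rung `FixedCutoffOverlap` for ALL WINDOWS `τ > 0` — a measurable Doeblin coupling of the step-`K` SZZ transition laws, all
# pairs of starts, truncated `wd_K`-currency mean `≤ 1 − η_K(τ)`

Helper file (seat `ym-line-csu-p1`, g12, free hands).  g11's `fixedCutoffOverlap_of_two_mul_eps_le` proved the registered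
plan-only rung of the line (`stub_fixedCutoffOverlapRung : FixedCutoffOverlap`, skeleton `harris_hybrid_v3`) for the windows with
`2 ε_K ≤ τ` only, the Doeblin minorisation of the SZZ kernels being available for lattice times `≥ 2`.  The minorisation now holds
at every lattice time (`doeblin_szz_haar_of_pos`, from the strict positivity of the SU(2) heat kernel, `heatKernelSU2_pos`), so
the same map-form Doeblin coupling (`…DoeblinCoupling`) gives:

* ★★ `fixedCutoffOverlap` — for EVERY `τ > 0`, `δ > 0`, cut-off `K`, coupling `γ` and family `F`: some `η > 0` (namely `c_K(τ)²`)
  such that for every jointly measurable strong-solution family `V` of the step-`K` dynamics there is a coupling `(T₃, T₄)` in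
  map form of the window-`τ/ε_K` transition laws (one auxiliary probability space, jointly measurable in `(u, v, ω)`, prescribed
  marginals on bounded measurable test functions) with `∫ 1 ∧ wd_K(T₃ u v, T₄ u v)/δ ≤ 1 − η` for ALL pairs `(u, v)`.

This is the statement `FixedCutoffOverlap` of the skeleton with `IsCoupling`/`dTr` unfolded, in the tree's copy of the TP
vocabulary (`Cruxes.WeightedAlmostInvariance.SynchronousShadow`: `Cfg`, `IsSolFamily`, `wdisc`).  THEOREMS ONLY, [folklore];
`η` depends on `K` (nothing cut-off-uniform is claimed: the organ 27873 `RegularPairOverlap` is the K-uniform version); K1 stays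
HELD/OPEN, no crux or summit is proved; the Yang–Mills mass gap is NOT proved.
-/

set_option autoImplicit false

noncomputable section

namespace Summit.QuantumFields.YangMills.Cruxes.WeightedAlmostInvariance.SynchronousShadow

open MeasureTheory ProbabilityTheory Filter Set
open scoped NNReal ENNReal BigOperators
open Literature.MathematicalPhysics.QuantumFieldTheory
open Literature.MathematicalPhysics.QuantumFieldTheory.Balaban1983to89
open Literature.MathematicalPhysics.QuantumLattice
open Summit.QuantumFields.YangMills.Theorems

variable (F : T3ContinuumYM3Torus.T3Family)

/-- ★★ **`FixedCutoffOverlap` for all windows `τ > 0`.**  At each fixed cut-off `K`, for every physical window length `τ > 0` and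
every `δ > 0` there is `η > 0` (namely `c_K(τ)²`, `c_K(τ)` the Doeblin constant of the step-`K` SZZ kernels at lattice time `τ/ε_K`)
such that for EVERY jointly measurable strong-solution family `V` of the step-`K` dynamics (any probability space, any flat driver)
there is a coupling `(T₃, T₄)` in map form of the window-`τ/ε_K` transition laws — one auxiliary probability space, jointly
measurable in `(u, v, ω)`, marginals `E f(T₃ u v) = P_{τ/ε_K} f(u)`, `E f(T₄ u v) = P_{τ/ε_K} f(v)` for bounded measurable `f` —
whose truncated currency has mean `∫ 1 ∧ wd_K(T₃ u v, T₄ u v)/δ dP₂ ≤ 1 − η` for ALL pairs `(u, v)`. [folklore] -/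
theorem fixedCutoffOverlap (γ : ℝ) (K : ℕ) (τ δ : ℝ) (hτ : 0 < τ) (hδ : 0 < δ) :
    ∃ η : ℝ, 0 < η ∧
      ∀ (Ω : Type) [MeasurableSpace Ω] (P : Measure Ω) [IsProbabilityMeasure P]
        (W : ℝ≥0 → Ω → (Edge 3 ((F.P K).sitesPerDir 0) × NoiseIdx 2 → ℝ)) (hW : IsFlatBrownian W P)
        (V : Cfg F K → ℝ≥0 → Ω → Cfg F K), IsSolFamily F γ K P W hW V →
        ∃ (Ω₂ : Type) (_ : MeasurableSpace Ω₂) (P₂ : Measure Ω₂) (T₃ T₄ : Cfg F K → Cfg F K → Ω₂ → Cfg F K),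
          (IsProbabilityMeasure P₂ ∧ Measurable (fun p : (Cfg F K × Cfg F K) × Ω₂ => T₃ p.1.1 p.1.2 p.2) ∧
            Measurable (fun p : (Cfg F K × Cfg F K) × Ω₂ => T₄ p.1.1 p.1.2 p.2) ∧
            ∀ f : Cfg F K → ℝ, Measurable f → (∃ M : ℝ, ∀ x, |f x| ≤ M) → ∀ x y,
              (∫ ω, f (T₃ x y ω) ∂P₂) = markovTransition V P (τ / (F.P K).eps).toNNReal f x ∧
              (∫ ω, f (T₄ x y ω) ∂P₂) = markovTransition V P (τ / (F.P K).eps).toNNReal f y) ∧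
          ∀ u v, (∫ ω, min 1 (wdisc F K (T₃ u v ω) (T₄ u v ω) / δ) ∂P₂) ≤ 1 - η := by
  classical
  -- the lattice, the coupling constant, the window in lattice units
  haveI := ColdStartUniversality.secondCountableTopology_su2
  haveI := ColdStartUniversality.borelSpace_config ((F.P K).sitesPerDir 0)
  have hε : 0 < (F.P K).eps := pow_pos (inv_pos.2 (Nat.cast_pos.2 (F.P K).L_pos)) _
  set β' : ℝ := (γ * (F.P K).eps)⁻¹ / 2 with hβ'
  set t : ℝ≥0 := (τ / (F.P K).eps).toNNReal with ht
  have htτ : 0 < τ / (F.P K).eps := div_pos hτ hε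
  have ht0 : 0 < (t : ℝ) := by rw [ht, Real.coe_toNNReal _ htτ.le]; exact htτ
  set H : Measure (Cfg F K) := Measure.pi fun _ : Edge 3 ((F.P K).sitesPerDir 0) =>
    haarProbability (Matrix.specialUnitaryGroup (Fin 2) ℂ) with hH
  haveI : IsProbabilityMeasure (haarProbability (Matrix.specialUnitaryGroup (Fin 2) ℂ)) := inferInstance
  haveI : IsProbabilityMeasure H := by rw [hH]; infer_instance
  -- THE kernels, the Doeblin constant at lattice time `t > 0`, the density
  obtain ⟨κ, hκM, -, hreal⟩ := ColdStartUniversality.exists_transitionKernel ((F.P K).sitesPerDir 0) β'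
  haveI := hκM
  obtain ⟨c, hc0, hc1, hmin⟩ :=
    ColdStartUniversality.doeblin_szz_haar_of_pos (L := (F.P K).sitesPerDir 0) β' κ hreal (t₀ := t) ht0
  have hmin_t : ∀ z, ENNReal.ofReal c • H ≤ κ t z := fun z => hmin z t le_rfl
  obtain ⟨p, hp, hrep, hlow⟩ :=
    ColdStartUniversality.exists_density_of_minorization (L := (F.P K).sitesPerDir 0) β' κ hreal ht0 hmin_t
  refine ⟨c ^ 2, by positivity, ?_⟩
  intro Ω mΩ P hP W hW V hV
  -- the solution family at the window time and its laws
  have hVt : Measurable fun q : Cfg F K × Ω => V q.1 t q.2 := hV.2 t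
  have hlaw : ∀ x, P.map (fun ω => V x t ω) = H.withDensity (p x) := by
    intro x
    rw [← hrep x, hreal t x Ω P W hW (V x) (hV.1 x).1 (hV.1 x).2]
  have hminae : ∀ x, ∀ᵐ w ∂H, ENNReal.ofReal c ≤ p x w := hlow
  have hcne : ENNReal.ofReal c ≠ ⊤ := ENNReal.ofReal_ne_top
  have hcle : ENNReal.ofReal c ≤ 1 := by
    rw [← ENNReal.ofReal_one]; exact ENNReal.ofReal_le_ofReal hc1
  obtain ⟨hdm, hd0, hd1, hdd⟩ := trunc_wdisc_props F K hδ
  -- the coupling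
  refine ⟨(Ω × Ω) × (Cfg F K × ℝ), inferInstance, (P.prod P).prod (H.prod (volume.restrict (Icc (0 : ℝ) 1))),
    fun x _ ω => if ENNReal.ofReal ω.2.2 * p x (V x t ω.1.1) ≤ ENNReal.ofReal c then ω.2.1 else V x t ω.1.1,
    fun _ y ω => if ENNReal.ofReal ω.2.2 * p y (V y t ω.1.2) ≤ ENNReal.ofReal c then ω.2.1 else V y t ω.1.2,
    ⟨TransportPerturbation.DoeblinCoupling.isProbabilityMeasure_aux P H,
      TransportPerturbation.DoeblinCoupling.measurable_select₃ (V := fun x ω => V x t ω) hVt hp _,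
      TransportPerturbation.DoeblinCoupling.measurable_select₄ (V := fun x ω => V x t ω) hVt hp _,
      fun f hf _ x y => ⟨?_, ?_⟩⟩, fun u v => ?_⟩
  · exact TransportPerturbation.DoeblinCoupling.integral_comp_select₃ P H (V := fun x ω => V x t ω) hVt hp hcne hlaw
      hminae hf x y
  · exact TransportPerturbation.DoeblinCoupling.integral_comp_select₄ P H (V := fun x ω => V x t ω) hVt hp hcne hlaw
      hminae hf x y
  · have h := TransportPerturbation.DoeblinCoupling.integral_trunc_le P H (V := fun x ω => V x t ω) hVt hp hcle hlaw
      hminae (d := fun u v => min 1 (wdisc F K u v / δ)) hdm hd0 hd1 hdd u v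
    rw [ENNReal.toReal_ofReal hc0.le] at h
    exact h

end Summit.QuantumFields.YangMills.Cruxes.WeightedAlmostInvariance.SynchronousShadow

end
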